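/- Free-seat work of WIDTH SEAT `ym-line-cbag-p1-w2` (prover-ym-line-cbag-p1-w2-g18-0), route `EguchiKawaiDirectionLadder`
(ideator ym-idea-2, LINE 8): the barrier entry's CONDITIONAL consequences of the named fact `EguchiKawaiBreakdown`
(`EguchiKawaiBreakdown.not_ekOpenLinesVanish{,_four}`, `ekDeformed_contrast`) restated UNCONDITIONALLY now that the fact is a
tree theorem (`EguchiKawaiBreakdown_holds`, LEAD g24).  One-line compositions; nothing new is proved.  HONEST FRAMING: the
Eguchi–Kawai BREAKDOWN direction only (naive single-site reduction fails at weak coupling, `d ≥ 3`); no summit statement, no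
mass gap, no continuum limit, no large-`N` reduction is proved or advanced. -/
import Summits.QuantumFields.YangMills.Theorems.EguchiKawaiDirectionLadderBreakdownHolds
import Literature.Barriers.QuantumFields.EguchiKawaiBreakdownDeformed
import HarnessLib

/-!
# Route `EguchiKawaiDirectionLadder`: unconditional consequences of `EguchiKawaiBreakdown_holds`

* `not_ekOpenLinesVanish_weakCoupling` — for every `d ≥ 3` the standing hypothesis `EKOpenLinesVanish d b` of the naive
  Eguchi–Kawai reduction FAILS for all sufficiently weak 't Hooft couplings `b > b₀(d)`;
* `not_ekOpenLinesVanish_four_weakCoupling` — the summit's dimension `d = 4`;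
* `ekDeformed_contrast_unconditional` — the naive/deformed contrast of `EguchiKawaiBreakdownDeformed.lean`: at the same weak
  couplings the undeformed (`h = 0`) order parameter does not tend to `0` in some direction, while the double-trace deformation
  drives every direction's order parameter below any `ε > 0` for `h ≥ h₀(ε)`, eventually in `N`.
-/

set_option autoImplicit false

open Filter Topology
open Literature.Barriers.QuantumFields

namespace Summit.QuantumFields.YangMills.Theorems.EguchiKawaiDirectionLadder

/-- **Naive Eguchi–Kawai reduction fails at weak coupling, every `d ≥ 3`** (unconditional form of
`EguchiKawaiBreakdown.not_ekOpenLinesVanish`). -/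
theorem not_ekOpenLinesVanish_weakCoupling {d : ℕ} (hd : 3 ≤ d) :
    ∃ b₀ : ℝ, 0 ≤ b₀ ∧ ∀ b : ℝ, b₀ < b → ¬ EKOpenLinesVanish d b :=
  EguchiKawaiBreakdown_holds.not_ekOpenLinesVanish hd

/-- **The summit's dimension**: for `d = 4` the reduction hypothesis fails at weak coupling (unconditional form of
`EguchiKawaiBreakdown.not_ekOpenLinesVanish_four`). -/
theorem not_ekOpenLinesVanish_four_weakCoupling :
    ∃ b₀ : ℝ, 0 ≤ b₀ ∧ ∀ b : ℝ, b₀ < b → ¬ EKOpenLinesVanish 4 b :=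
  EguchiKawaiBreakdown_holds.not_ekOpenLinesVanish_four

/-- **Naive versus double-trace-deformed single-site model, unconditionally** (`ekDeformed_contrast` with its hypothesis
discharged): for `d ≥ 3` and all `b > b₀(d)`, the undeformed order parameter fails to vanish in some direction, whereas for every
`ε > 0` the deformed one is eventually `≤ ε` in every direction once `h ≥ h₀(ε)`. -/
theorem ekDeformed_contrast_unconditional {d : ℕ} (hd : 3 ≤ d) :
    ∃ b₀ : ℝ, 0 ≤ b₀ ∧ ∀ b : ℝ, b₀ < b →
      (∃ μ : Fin d, ¬ Tendsto (fun N : ℕ => ekDeformedOrderParameter d N b 0 μ) atTop (𝓝 0)) ∧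
      (∀ ε : ℝ, 0 < ε → ∃ h₀ : ℝ, 0 ≤ h₀ ∧ ∀ h : ℝ, h₀ ≤ h → ∀ μ : Fin d,
        ∀ᶠ N : ℕ in atTop, ekDeformedOrderParameter d N b h μ ≤ ε) :=
  ekDeformed_contrast EguchiKawaiBreakdown_holds hd

end Summit.QuantumFields.YangMills.Theorems.EguchiKawaiDirectionLadder
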